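import Literature.MathematicalPhysics.QuantumManyBody.PeriodicMaxFormPositivity
import Literature.MathematicalPhysics.QuantumManyBody.PeriodicBoseGasTagged
import Literature.MathematicalPhysics.QuantumManyBody.PeriodicBoseGasFracEnergy
import HarnessLib

/-!
# Simplicity of the ground state of the periodic `N`-boson form (Reed–Simon IV, Thm XIII.48 (a))

Topic `Literature/MathematicalPhysics/QuantumManyBody`, sequel of `PeriodicMaxFormGroundStates.lean` and
`PeriodicMaxFormPositivity.lean`; third support file of the proof of the named fact
`Literature.MathematicalPhysics.QuantumManyBody.PeriodicGroundStateNondegenerateIntegrable`, whose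
discharge `PeriodicGroundStateNondegenerateIntegrable_holds` (in `PeriodicGroundStateNondegenerateProofs.lean`)
is `two_mul_periodicGroundStateEnergy_lt_kyFanTwo_of_lintegral_ne_top` below.

For `L > 0`, `N ≥ 1` and a measurable pair profile `v ≥ 0` with `W = ∑_{i<j} v^per(xᵢ - xⱼ) ∈ L¹` of the
cell, the ground-state class `𝓜 = maxFormGroundStates v N L` of the maximal form in the Bose sector is
one-dimensional, by Reed–Simon's argument for Thm XIII.44 run on the lattice properties of `𝓜`
(`PeriodicMaxFormGroundStates.lean`: `𝓜` is a cone stable under `|·|`, `conj`, `re`, `im`, `(·)⁺`, `(·)⁻`)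
and the Faris–Simon positivity of its non-negative elements (`PeriodicMaxFormPositivity.lean`:
`ae_ne_zero_of_mem_maxFormGroundStates`):

* `absLp_eq_or_eq_neg_of_conjLp_eq` — a real ground state has constant sign (`θ⁺ ≠ 0` forces `θ⁺ > 0`
  a.e., whence `θ⁻ = 0`);
* `re_inner_pos_of_absLp_eq`, `eq_zero_of_conjLp_eq_of_inner_eq_zero` — two non-negative non-zero
  ground states are not orthogonal, so a real ground state orthogonal to a positive one vanishes;
* `exists_eq_smul_of_mem_maxFormGroundStates`, `inner_ne_zero_of_mem_maxFormGroundStates` — `𝓜 ⊆ ℂ·η`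
  for any non-negative non-zero `η ∈ 𝓜`; two non-zero ground states are never orthogonal;
* `two_mul_periodicGroundStateEnergy_lt_kyFanTwo` — hence the two lowest form eigenvalues differ
  (`κ₂ < κ₁` for the Gram operator of the compact form embedding: otherwise the images of the two
  orthonormal top eigenvectors are orthogonal non-zero elements of `𝓜`,
  `formEmbed_mem_maxFormGroundStates_of_gramOp_eq`), i.e. `2E₀ < kyFanTwo v N L`
  (`periodicGroundStateEnergy_eq_ofReal`, `kyFanTwo_eq_ofReal`);
* `lintegral_cellN_periodicInteraction_ne_top_of_lintegral_ne_top` — `∫_{ℝ³} v(|x|)dx < ∞` gives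
  `W ∈ L¹` of the cell (induction on `N`, `lintegral_cell_periodizedPotential_sub`).

## References

* M. Reed, B. Simon, *Methods of Modern Mathematical Physics IV* (1978), §XIII.12, Thms XIII.43, XIII.44,
  XIII.48, XIII.64. [ReedSimonIV1978]
* W. Faris, B. Simon, Duke Math. J. 42 (1975) 559–567, Thm. 1. [FarisSimon1975]
-/

noncomputable section

open MeasureTheory Filter Set Complex UnitAddTorus
open scoped ENNReal NNReal Topology InnerProductSpace ComplexConjugate
open Literature.Analysis.FunctionSpaces Literature.Analysis.OperatorTheory Literature.Analysis.InnerProduct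

namespace Literature.MathematicalPhysics.QuantumManyBody.BoseGas

-- The measure on `ℝ/ℤ` is the Haar PROBABILITY measure, as in `PeriodicFormDomain.lean`.
attribute [local instance] formDomain_measureSpace formDomain_isProbabilityMeasure formDomain_isProbabilityMeasure_pi

variable {N : ℕ} {L : ℝ} {v : ℝ → ℝ≥0∞}

/-- Local notation for the Hilbert space `L²((ℝ/ℤ)^{3N})`, as in `PeriodicFormDomain.lean`. -/
local notation "L2T " N':max => Lp ℂ 2 (volume : Measure (UnitAddTorus (Fin N' × Fin 3)))

/-! ### Lattice identities for real and non-negative classes -/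

section Simplicity

/-- `||η|| = |η|`. [folklore] -/
theorem absLp_absLp (η : L2T N) : absLp (absLp η) = absLp η := by
  refine Lp.ext ?_
  filter_upwards [coeFn_absLp (absLp η), coeFn_absLp η] with t h1 h2
  rw [h1, h2, Complex.norm_real, norm_norm]

/-- `|-η| = |η|`. [folklore] -/
theorem absLp_neg (η : L2T N) : absLp (-η) = absLp η := by
  refine Lp.ext ?_
  filter_upwards [coeFn_absLp (-η), coeFn_absLp η, Lp.coeFn_neg η] with t h1 h2 h3
  rw [h1, h2, h3, Pi.neg_apply, norm_neg]

/-- `|η|` is real. [folklore] -/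
theorem conjLp_absLp (η : L2T N) : conjLp (absLp η) = absLp η := by
  refine Lp.ext ?_
  filter_upwards [coeFn_conjLp (absLp η), coeFn_absLp η] with t h1 h2
  rw [h1, h2, Complex.conj_ofReal]

/-- `re η` is real. [folklore] -/
theorem conjLp_reLp (η : L2T N) : conjLp (reLp η) = reLp η := by
  refine Lp.ext ?_
  filter_upwards [coeFn_conjLp (reLp η), coeFn_reLp η] with t h1 h2
  rw [h1, h2, Complex.conj_ofReal]

/-- `im η` is real. [folklore] -/
theorem conjLp_imLp (η : L2T N) : conjLp (imLp η) = imLp η := by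
  refine Lp.ext ?_
  filter_upwards [coeFn_conjLp (imLp η), coeFn_imLp η] with t h1 h2
  rw [h1, h2, Complex.conj_ofReal]

/-- `|η⁺| = η⁺`. [folklore] -/
theorem absLp_posPartLp (η : L2T N) : absLp (posPartLp η) = posPartLp η := by
  refine Lp.ext ?_
  filter_upwards [coeFn_absLp (posPartLp η), coeFn_posPartLp η] with t h1 h2
  rw [h1, h2, Complex.norm_real, Real.norm_of_nonneg (le_max_right _ _)]

/-- A real class is pointwise real a.e. [folklore] -/
theorem ae_conj_eq_of_conjLp_eq {η : L2T N} (h : conjLp η = η) :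
    ∀ᵐ t ∂(volume : Measure (UnitAddTorus (Fin N × Fin 3))),
      conj ((η : UnitAddTorus (Fin N × Fin 3) → ℂ) t) = (η : UnitAddTorus (Fin N × Fin 3) → ℂ) t := by
  filter_upwards [coeFn_conjLp η] with t ht
  rw [← ht, h]

/-- Real combinations of real classes are real. [folklore] -/
theorem conjLp_sub_ofReal_smul {θ η : L2T N} (hθ : conjLp θ = θ) (hη : conjLp η = η) (c : ℝ) :
    conjLp (θ - (c : ℂ) • η) = θ - (c : ℂ) • η := by
  refine Lp.ext ?_
  filter_upwards [coeFn_conjLp (θ - (c : ℂ) • η), Lp.coeFn_sub θ ((c : ℂ) • η), Lp.coeFn_smul (c : ℂ) η,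
    ae_conj_eq_of_conjLp_eq hθ, ae_conj_eq_of_conjLp_eq hη] with t h1 h2 h3 h4 h5
  rw [h1, h2, Pi.sub_apply, h3, Pi.smul_apply, smul_eq_mul, map_sub, map_mul, Complex.conj_ofReal, h4, h5]

/-- `⟪conj x, conj y⟫ = conj ⟪x, y⟫`. [folklore] -/
theorem inner_conjLp_conjLp (x y : L2T N) : ⟪conjLp x, conjLp y⟫_ℂ = conj ⟪x, y⟫_ℂ := by
  rw [L2.inner_def, L2.inner_def, ← integral_conj]
  refine integral_congr_ae ?_
  filter_upwards [coeFn_conjLp x, coeFn_conjLp y] with t h1 h2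
  rw [h1, h2, RCLike.inner_apply, RCLike.inner_apply, map_mul, Complex.conj_conj]

/-- Inner products of real classes are real. [folklore] -/
theorem conj_inner_of_conjLp_eq {η θ : L2T N} (hη : conjLp η = η) (hθ : conjLp θ = θ) :
    conj ⟪η, θ⟫_ℂ = ⟪η, θ⟫_ℂ := by
  rw [← inner_conjLp_conjLp, hη, hθ]

/-! ### Perron–Frobenius for the maximal form: the ground-state class is one-dimensional -/

/-- **Two non-negative non-zero ground states are never orthogonal**: `re⟪η, θ⟫ > 0`, since both are
a.e. strictly positive (`ae_ne_zero_of_mem_maxFormGroundStates`). [cite: ReedSimonIV1978, Thm XIII.44 (proof)] -/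
theorem re_inner_pos_of_absLp_eq (hL : 0 < L) (hv : Measurable v)
    (hW : ∫⁻ X in cellN N L, periodicInteraction v L X ≠ ⊤) (hE : periodicGroundStateEnergy v N L ≠ ⊤)
    {η θ : L2T N} (hη : η ∈ maxFormGroundStates v N L) (hηabs : absLp η = η) (hη0 : η ≠ 0)
    (hθ : θ ∈ maxFormGroundStates v N L) (hθabs : absLp θ = θ) (hθ0 : θ ≠ 0) : 0 < (⟪η, θ⟫_ℂ).re := by
  have hη' := ae_ne_zero_of_mem_maxFormGroundStates hL hv hW hE hη hηabs hη0
  have hθ' := ae_ne_zero_of_mem_maxFormGroundStates hL hv hW hE hθ hθabs hθ0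
  have hηae : ∀ᵐ t ∂(volume : Measure (UnitAddTorus (Fin N × Fin 3))), (η : UnitAddTorus (Fin N × Fin 3) → ℂ) t =
      ((‖(η : UnitAddTorus (Fin N × Fin 3) → ℂ) t‖ : ℝ) : ℂ) := by
    have h := coeFn_absLp η
    rw [hηabs] at h
    exact h
  have hθae : ∀ᵐ t ∂(volume : Measure (UnitAddTorus (Fin N × Fin 3))), (θ : UnitAddTorus (Fin N × Fin 3) → ℂ) t =
      ((‖(θ : UnitAddTorus (Fin N × Fin 3) → ℂ) t‖ : ℝ) : ℂ) := by
    have h := coeFn_absLp θ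
    rw [hθabs] at h
    exact h
  rw [L2.inner_def, ← RCLike.re_to_complex, ← integral_re (L2.integrable_inner η θ)]
  refine (integral_pos_iff_support_of_nonneg_ae ?_ (L2.integrable_inner η θ).re).2 ?_
  · filter_upwards [hηae, hθae] with t h1 h2
    rw [Pi.zero_apply, RCLike.inner_apply, h1, h2, Complex.conj_ofReal, ← Complex.ofReal_mul, RCLike.re_to_complex,
      Complex.ofReal_re]
    positivity
  · have hsupp : ∀ᵐ t ∂(volume : Measure (UnitAddTorus (Fin N × Fin 3))),
        t ∈ Function.support fun t => RCLike.re ⟪(η : UnitAddTorus (Fin N × Fin 3) → ℂ) t,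
          (θ : UnitAddTorus (Fin N × Fin 3) → ℂ) t⟫_ℂ := by
      filter_upwards [hη', hθ', hηae, hθae] with t h1 h2 h3 h4
      rw [Function.mem_support, RCLike.inner_apply, h3, h4, Complex.conj_ofReal, ← Complex.ofReal_mul,
        RCLike.re_to_complex, Complex.ofReal_re]
      rw [h3] at h1
      rw [h4] at h2
      have h1' : ‖(η : UnitAddTorus (Fin N × Fin 3) → ℂ) t‖ ≠ 0 := fun h => h1 (by rw [h, Complex.ofReal_zero])
      have h2' : ‖(θ : UnitAddTorus (Fin N × Fin 3) → ℂ) t‖ ≠ 0 := fun h => h2 (by rw [h, Complex.ofReal_zero])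
      exact mul_ne_zero h2' h1'
    have hcompl : volume (Function.support fun t => RCLike.re ⟪(η : UnitAddTorus (Fin N × Fin 3) → ℂ) t,
        (θ : UnitAddTorus (Fin N × Fin 3) → ℂ) t⟫_ℂ)ᶜ = 0 := mem_ae_iff.1 hsupp
    rw [measure_congr (ae_eq_univ.2 hcompl), measure_univ]
    exact one_pos

/-- **Real ground states have constant sign**: for a real `θ ∈ maxFormGroundStates v N L`, either
`|θ| = θ` or `|θ| = -θ` (`θ⁺ ∈ maxFormGroundStates` is a.e. `> 0` as soon as it is `≠ 0`, forcing `θ⁻ = 0`).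
[cite: ReedSimonIV1978, Thm XIII.44 (proof)] -/
theorem absLp_eq_or_eq_neg_of_conjLp_eq (hL : 0 < L) (hv : Measurable v)
    (hW : ∫⁻ X in cellN N L, periodicInteraction v L X ≠ ⊤) (hE : periodicGroundStateEnergy v N L ≠ ⊤)
    {θ : L2T N} (hθ : θ ∈ maxFormGroundStates v N L) (hreal : conjLp θ = θ) : absLp θ = θ ∨ absLp θ = -θ := by
  have hpos := posPartLp_eq_of_conjLp_eq hreal
  have hneg := negPartLp_eq_of_conjLp_eq hreal
  by_cases h0 : posPartLp θ = 0
  · right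
    rw [h0] at hpos
    have h2 : absLp θ + θ = 0 := by
      have h := hpos.symm
      rw [smul_eq_zero] at h
      exact h.resolve_left (by norm_num)
    exact eq_neg_of_add_eq_zero_left h2
  · left
    have hmem := posPartLp_mem_maxFormGroundStates hL hv hW hE hθ hreal
    have hae := ae_ne_zero_of_mem_maxFormGroundStates hL hv hW hE hmem (absLp_posPartLp θ) h0
    have hneg0 : negPartLp θ = 0 := by
      refine Lp.eq_zero_iff_ae_eq_zero.2 ?_
      filter_upwards [hae, coeFn_posPartLp θ, coeFn_negPartLp θ] with t h1 h2 h3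
      rw [h3, Pi.zero_apply, Complex.ofReal_eq_zero, max_eq_right_iff, neg_nonpos]
      rw [h2] at h1
      by_contra hlt
      push Not at hlt
      exact h1 (by rw [max_eq_right hlt.le, Complex.ofReal_zero])
    rw [hneg0] at hneg
    have h2 : absLp θ - θ = 0 := by
      have h := hneg.symm
      rw [smul_eq_zero] at h
      exact h.resolve_left (by norm_num)
    exact sub_eq_zero.1 h2

/-- **A real ground state orthogonal to a non-negative non-zero ground state vanishes.**
[cite: ReedSimonIV1978, Thm XIII.44 (proof)] -/
theorem eq_zero_of_conjLp_eq_of_inner_eq_zero (hL : 0 < L) (hv : Measurable v)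
    (hW : ∫⁻ X in cellN N L, periodicInteraction v L X ≠ ⊤) (hE : periodicGroundStateEnergy v N L ≠ ⊤)
    {η θ : L2T N} (hη : η ∈ maxFormGroundStates v N L) (hηabs : absLp η = η) (hη0 : η ≠ 0)
    (hθ : θ ∈ maxFormGroundStates v N L) (hreal : conjLp θ = θ) (horth : ⟪η, θ⟫_ℂ = 0) : θ = 0 := by
  by_contra hθ0
  rcases absLp_eq_or_eq_neg_of_conjLp_eq hL hv hW hE hθ hreal with h | h
  · have h1 := re_inner_pos_of_absLp_eq hL hv hW hE hη hηabs hη0 hθ h hθ0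
    rw [horth, Complex.zero_re] at h1
    exact lt_irrefl _ h1
  · have hθ' : absLp (-θ) = -θ := by rw [absLp_neg, h]
    have h1 := re_inner_pos_of_absLp_eq hL hv hW hE hη hηabs hη0 (neg_mem_maxFormGroundStates hθ) hθ' (neg_ne_zero.2 hθ0)
    rw [inner_neg_right, horth, neg_zero, Complex.zero_re] at h1
    exact lt_irrefl _ h1

/-- **Real ground states are multiples of a non-negative one.** [cite: ReedSimonIV1978, Thm XIII.44 (proof)] -/
theorem exists_eq_ofReal_smul_of_conjLp_eq (hL : 0 < L) (hv : Measurable v)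
    (hW : ∫⁻ X in cellN N L, periodicInteraction v L X ≠ ⊤) (hE : periodicGroundStateEnergy v N L ≠ ⊤)
    {η θ : L2T N} (hη : η ∈ maxFormGroundStates v N L) (hηabs : absLp η = η) (hη0 : η ≠ 0)
    (hθ : θ ∈ maxFormGroundStates v N L) (hreal : conjLp θ = θ) : ∃ c : ℝ, θ = (c : ℂ) • η := by
  have hηreal : conjLp η = η := by
    rw [← hηabs]
    exact conjLp_absLp η
  obtain ⟨r, hr⟩ : ∃ r : ℝ, (r : ℂ) = ⟪η, θ⟫_ℂ :=
    ⟨(⟪η, θ⟫_ℂ).re, Complex.conj_eq_iff_re.1 (conj_inner_of_conjLp_eq hηreal hreal)⟩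
  have hn0 : ‖η‖ ≠ 0 := norm_ne_zero_iff.2 hη0
  have hself : ⟪η, η⟫_ℂ = ((‖η‖ : ℝ) : ℂ) ^ 2 := inner_self_eq_norm_sq_to_K (𝕜 := ℂ) η
  refine ⟨r / ‖η‖ ^ 2, ?_⟩
  have hmem : θ - ((r / ‖η‖ ^ 2 : ℝ) : ℂ) • η ∈ maxFormGroundStates v N L :=
    sub_mem_maxFormGroundStates hL hv hW hE hθ (smul_mem_maxFormGroundStates _ hη)
  have hreal' := conjLp_sub_ofReal_smul hreal hηreal (r / ‖η‖ ^ 2)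
  have hcoef : ((r / ‖η‖ ^ 2 : ℝ) : ℂ) * ((‖η‖ : ℝ) : ℂ) ^ 2 = (r : ℂ) := by
    rw [← Complex.ofReal_pow, ← Complex.ofReal_mul, div_mul_cancel₀ _ (pow_ne_zero 2 hn0)]
  have horth : ⟪η, θ - ((r / ‖η‖ ^ 2 : ℝ) : ℂ) • η⟫_ℂ = 0 := by
    rw [inner_sub_right, inner_smul_right, hself, hcoef, ← hr, sub_self]
  have h0 := eq_zero_of_conjLp_eq_of_inner_eq_zero hL hv hW hE hη hηabs hη0 hmem hreal' horth
  exact sub_eq_zero.1 h0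

/-- **The ground-state class of the maximal form is one-dimensional** (Perron–Frobenius,
Reed–Simon Thm XIII.44 at the level of the maximal form): every ground state is a complex multiple of
any fixed non-negative non-zero ground state. [cite: ReedSimonIV1978, Thms XIII.43–XIII.44 and Thm XIII.48 (a)] -/
theorem exists_eq_smul_of_mem_maxFormGroundStates (hL : 0 < L) (hv : Measurable v)
    (hW : ∫⁻ X in cellN N L, periodicInteraction v L X ≠ ⊤) (hE : periodicGroundStateEnergy v N L ≠ ⊤)
    {η ξ : L2T N} (hη : η ∈ maxFormGroundStates v N L) (hηabs : absLp η = η) (hη0 : η ≠ 0)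
    (hξ : ξ ∈ maxFormGroundStates v N L) : ∃ c : ℂ, ξ = c • η := by
  obtain ⟨a, ha⟩ := exists_eq_ofReal_smul_of_conjLp_eq hL hv hW hE hη hηabs hη0
    (reLp_mem_maxFormGroundStates hL hv hW hE hξ) (conjLp_reLp ξ)
  obtain ⟨b, hb⟩ := exists_eq_ofReal_smul_of_conjLp_eq hL hv hW hE hη hηabs hη0
    (imLp_mem_maxFormGroundStates hL hv hW hE hξ) (conjLp_imLp ξ)
  refine ⟨(a : ℂ) + Complex.I * (b : ℂ), ?_⟩
  rw [← reLp_add_I_smul_imLp ξ, ha, hb, smul_smul, ← add_smul]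

/-- **Two non-zero ground states are never orthogonal** (the ground-state class is spanned by one
a.e. positive function). [cite: ReedSimonIV1978, Thm XIII.44] -/
theorem inner_ne_zero_of_mem_maxFormGroundStates (hL : 0 < L) (hv : Measurable v)
    (hW : ∫⁻ X in cellN N L, periodicInteraction v L X ≠ ⊤) (hE : periodicGroundStateEnergy v N L ≠ ⊤)
    {x y : L2T N} (hx : x ∈ maxFormGroundStates v N L) (hy : y ∈ maxFormGroundStates v N L) (hx0 : x ≠ 0)
    (hy0 : y ≠ 0) : ⟪x, y⟫_ℂ ≠ 0 := by
  have hη : absLp x ∈ maxFormGroundStates v N L := absLp_mem_maxFormGroundStates hx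
  have hη0 : absLp x ≠ 0 := fun h => by
    have h1 := norm_absLp x
    rw [h, norm_zero] at h1
    exact hx0 (norm_eq_zero.1 h1.symm)
  obtain ⟨a, ha⟩ := exists_eq_smul_of_mem_maxFormGroundStates hL hv hW hE hη (absLp_absLp x) hη0 hx
  obtain ⟨b, hb⟩ := exists_eq_smul_of_mem_maxFormGroundStates hL hv hW hE hη (absLp_absLp x) hη0 hy
  have ha0 : a ≠ 0 := by
    rintro rfl
    exact hx0 (by rw [ha, zero_smul])
  have hb0 : b ≠ 0 := by
    rintro rfl
    exact hy0 (by rw [hb, zero_smul])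
  have hn : (‖absLp x‖ : ℂ) ≠ 0 := by exact_mod_cast norm_ne_zero_iff.2 hη0
  rw [ha, hb, inner_smul_left, inner_smul_right, inner_self_eq_norm_sq_to_K]
  exact mul_ne_zero ((map_ne_zero _).2 ha0) (mul_ne_zero hb0 (pow_ne_zero 2 hn))

/-! ### Simplicity of the bosonic ground-state energy -/

/-- **The lowest eigenvalue of the periodic `N`-boson form is simple** (`W ∈ L¹` of the cell): in Ky Fan
form `2 E₀ < kyFanTwo v N L`. If the two lowest form eigenvalues coincided (`κ₂ = κ₁` for the Gram
operator of the compact form embedding), the images `ι e₁ ⊥ ι e₂` of the two orthonormal top eigenvectors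
would be two orthogonal non-zero ground states of the maximal form (`formEmbed_mem_maxFormGroundStates_of_gramOp_eq`),
contradicting `inner_ne_zero_of_mem_maxFormGroundStates`; hence `κ₂ < κ₁`, i.e. `E₁ < E₂`, and
`2E₁ < E₁ + E₂ = kyFanTwo` (`periodicGroundStateEnergy_eq_ofReal`, `kyFanTwo_eq_ofReal`).
[cite: ReedSimonIV1978, Thm XIII.48 (a), Thms XIII.43–XIII.44, Thm XIII.64] -/
theorem two_mul_periodicGroundStateEnergy_lt_kyFanTwo (hN : 1 ≤ N) (hL : 0 < L) (hv : Measurable v)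
    (hW : ∫⁻ X in cellN N L, periodicInteraction v L X ≠ ⊤) :
    2 * periodicGroundStateEnergy v N L < kyFanTwo v N L := by
  obtain ⟨d⟩ := nonempty_twoModeData hL hv hW hN
  have hE := periodicGroundStateEnergy_eq_ofReal d
  have hK := kyFanTwo_eq_ofReal d
  have hEtop : periodicGroundStateEnergy v N L ≠ ⊤ := by
    rw [hE]
    exact ENNReal.ofReal_ne_top
  have hlt : d.κ₂ < d.κ₁ := by
    refine lt_of_le_of_ne d.κ₂_le_κ₁ fun heq => ?_
    have h1 : formEmbed hL hv hW d.e₁ ∈ maxFormGroundStates v N L :=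
      formEmbed_mem_maxFormGroundStates_of_gramOp_eq hL hv hW d d.gramOp_e₁
    have h2 : formEmbed hL hv hW d.e₂ ∈ maxFormGroundStates v N L :=
      formEmbed_mem_maxFormGroundStates_of_gramOp_eq hL hv hW d (by
        have h := d.gramOp_e₂
        rw [heq] at h
        exact h)
    have hne1 : formEmbed hL hv hW d.e₁ ≠ 0 := fun h => by
      have h' := d.norm_map_e₁_sq
      rw [h, norm_zero, zero_pow two_ne_zero] at h'
      exact d.κ₁_pos.ne h'
    have hne2 : formEmbed hL hv hW d.e₂ ≠ 0 := fun h => by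
      have h' := d.norm_map_e₂_sq
      rw [h, norm_zero, zero_pow two_ne_zero] at h'
      exact d.κ₂_pos.ne h'
    exact inner_ne_zero_of_mem_maxFormGroundStates hL hv hW hEtop h1 h2 hne1 hne2 d.inner_map_e₁_map_e₂
  have h1 := twoModeData_one_le_inv_κ₁ d
  have hinv : d.κ₁⁻¹ < d.κ₂⁻¹ := (inv_lt_inv₀ d.κ₁_pos d.κ₂_pos).2 hlt
  rw [hE, hK]
  have h2 : (2 : ℝ≥0∞) * ENNReal.ofReal (d.κ₁⁻¹ - 1) = ENNReal.ofReal (2 * (d.κ₁⁻¹ - 1)) := by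
    rw [ENNReal.ofReal_mul zero_le_two, ENNReal.ofReal_ofNat]
  rw [h2]
  exact (ENNReal.ofReal_lt_ofReal_iff_of_nonneg (by linarith)).2 (by linarith)

/-! ### Integrable pair profiles give `W ∈ L¹` of the cell -/

/-- The periodic interaction of a measurable profile is measurable (copy of the lemma of
`DiluteBoseGasUpperBoundLocalization.lean`, kept private to avoid that import). [folklore] -/
private theorem measurable_periodicInteraction_simp (hv : Measurable v) (L : ℝ) :
    Measurable (periodicInteraction (N := N) v L) := by
  unfold periodicInteraction periodizedPotential
  refine Finset.measurable_sum _ fun i _ => Finset.measurable_sum _ fun j _ => ?_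
  exact (Measurable.tsum fun n => hv.comp (measurable_id.sub_const _).norm).comp
    ((measurable_config_apply i).sub (measurable_config_apply j))

/-- `x ↦ v^per(x - y)` is measurable. [folklore] -/
private theorem measurable_periodizedPotential_sub (hv : Measurable v) (L : ℝ) (y : Space) :
    Measurable fun x : Space => periodizedPotential v L (x - y) := by
  unfold periodizedPotential
  exact (Measurable.tsum fun n => hv.comp (measurable_id.sub_const _).norm).comp (measurable_id.sub_const y)

/-- **The pair interaction of an integrable profile is integrable on the cell**: if `∫_{ℝ³} v(|x|) dx < ∞`
then `∫_{[0,L)^{3N}} ∑_{i<j} v^per(xᵢ - xⱼ) dX < ∞` (`= C(N,2) L^{3(N-1)} ∫ v`; induction on `N`, unfolding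
the periodisation in the first particle, `lintegral_cell_periodizedPotential_sub`). [folklore] -/
theorem lintegral_cellN_periodicInteraction_ne_top_of_lintegral_ne_top (hL : 0 < L) (hv : Measurable v)
    (hint : (∫⁻ x : Space, v ‖x‖) ≠ ⊤) (N : ℕ) : ∫⁻ X in cellN N L, periodicInteraction v L X ≠ ⊤ := by
  induction N with
  | zero =>
    have h0 : ∀ X : Config 0, periodicInteraction v L X = 0 := fun X => by simp [periodicInteraction]
    simp [h0]
  | succ m ih =>
    have hinner : ∀ Y : Config m, ∫⁻ x in cell L, periodicInteraction v L (Matrix.vecCons x Y) =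
        (m : ℝ≥0∞) * (∫⁻ z : Space, v ‖z‖) + periodicInteraction v L Y * ENNReal.ofReal L ^ 3 := by
      intro Y
      have hfun : (fun x : Space => periodicInteraction v L (Matrix.vecCons x Y)) =
          fun x => (∑ j : Fin m, periodizedPotential v L (x - Y j)) + periodicInteraction v L Y := by
        funext x
        rw [periodicInteraction_succ]
        simp only [Matrix.cons_val_zero, Matrix.cons_val_succ, Matrix.tail_cons]
      rw [hfun, lintegral_add_right _ measurable_const,
        lintegral_finsetSum _ (fun j _ => measurable_periodizedPotential_sub hv L (Y j)), setLIntegral_const, volume_cell]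
      simp only [lintegral_cell_periodizedPotential_sub hL hv, Finset.sum_const, Finset.card_univ, Fintype.card_fin,
        nsmul_eq_mul]
    rw [lintegral_cellN_succ L (measurable_periodicInteraction_simp hv L)]
    simp only [hinner]
    rw [lintegral_add_left measurable_const, setLIntegral_const, volume_cellN,
      lintegral_mul_const _ (measurable_periodicInteraction_simp hv L)]
    exact ENNReal.add_ne_top.2 ⟨ENNReal.mul_ne_top (ENNReal.mul_ne_top (ENNReal.natCast_ne_top m) hint)
      (ENNReal.pow_ne_top (ENNReal.pow_ne_top ENNReal.ofReal_ne_top)),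
      ENNReal.mul_ne_top ih (ENNReal.pow_ne_top ENNReal.ofReal_ne_top)⟩

/-- **Reed–Simon IV Thm XIII.48 (a) on the torus, assembled**: for `N ≥ 1`, `L > 0`, `v` measurable with
`∫_{ℝ³} v(|x|) dx < ∞`, `2 · periodicGroundStateEnergy v N L < kyFanTwo v N L`. [cite: ReedSimonIV1978, Thm XIII.48 (a)] -/
theorem two_mul_periodicGroundStateEnergy_lt_kyFanTwo_of_lintegral_ne_top (hN : 1 ≤ N) (hL : 0 < L)
    (hv : Measurable v) (hint : (∫⁻ x : Space, v ‖x‖) ≠ ⊤) :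
    2 * periodicGroundStateEnergy v N L < kyFanTwo v N L :=
  two_mul_periodicGroundStateEnergy_lt_kyFanTwo hN hL hv
    (lintegral_cellN_periodicInteraction_ne_top_of_lintegral_ne_top hL hv hint N)

end Simplicity

end Literature.MathematicalPhysics.QuantumManyBody.BoseGas

end
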